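import Literature.NumberTheory.Sieve.MatomakiRadziwillLemma4LipschitzOfCentral4
import Literature.NumberTheory.Sieve.MatomakiRadziwillLemma3VK
import Literature.NumberTheory.LFunctions.GranvilleSoundararajanTheorem4Proofs
import HarnessLib

/-!
# Matomäki–Radziwiłł 2016, Theorem 3: Lemma 4 discharged; Theorem 3 from a Vinogradov–Korobov region alone

Topic `Literature/NumberTheory/Sieve`.  Everything in this file is PROVED; no definitions, no named facts.

K. Matomäki, M. Radziwiłł, *Multiplicative functions in short intervals*, Ann. of Math. (2) 183 (2016),
Theorem 3 (arXiv:1501.04585, p. 6; proof §9, p. 19): for real multiplicative `f : ℕ → [-1, 1]`,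
`2 ≤ h ≤ X/(log X)^{1/5}`-type ranges and `δ > 0`, the short average `(1/h) ∑_{x ≤ n ≤ x+h} f(n)` is
within `δ + O((log X)^{-1/50})`-type error of the dyadic long average for all but
`O(X (log h)^{1/3}/(δ² h^{δ/25}) + X/(δ² (log X)^{1/50}))` integers `x ∈ [X, 2X]` (the named fact
`MatomakiRadziwill2016_theorem3` of `MatomakiRadziwill.lean`, as printed).

The tree proves the whole printed deduction: §9 (`MatomakiRadziwill2016_theorem3_of_prop1_real`, from
Lemma 14 — proved, `MatomakiRadziwill2016_lemma14_real_holds` —, Lemma 4 and Proposition 1), §8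
(`MatomakiRadziwill2016_prop1_of_lemma3_lemma11`), Lemma 3 from the sharp Halász theorem of
Granville–Soundararajan (proved) and the Vinogradov–Korobov prime tail
(`MatomakiRadziwill2016_lemma3_of_GS_tail`, `TwistedPrimeSumTail.pretentiousDistSq_one_twist_tail_ge_of_vk`),
Lemma 11 (`MatomakiRadziwill2016_lemma11_of_vk`).  This file closes the Lemma 4 input and assembles:

* `MatomakiRadziwill2016_lemma4_lipschitz_holds`, `MatomakiRadziwill2016_lemma4_holds` — **Lemma 4**
  (the Lipschitz bound "due to Granville and Soundararajan") and its displayed estimate (Lipsch), now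
  unconditional: the last input `GranvilleSoundararajan2003_theorem4_central` of
  `MatomakiRadziwill2016_lemma4_of_theorem4_central` (`MatomakiRadziwillLemma4LipschitzOfCentral4.lean`) is
  proved in `GranvilleSoundararajanTheorem4Proofs.lean`;
* `MatomakiRadziwill2016_theorem3_of_vk : 0 < c → HasVKZeroFreeRegion c T₀ → MatomakiRadziwill2016_theorem3`
  — **Theorem 3 from any Vinogradov–Korobov zero-free region for Dirichlet `L`-functions** (the
  inexplicit interface of `VinogradovKorobovDirichlet.lean`; any constant, any starting height), and its
  specialisation `MatomakiRadziwill2016_theorem3_of_khale` to Khale's explicit region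
  (`Khale2024_zeroFreeRegion`, Q. J. Math. 75 (2024), Thm 1.1);
* the same for **Theorem 1** (`MatomakiRadziwill2016_theorem1_of_vk`, `…_of_khale`) and for **parity.S38**
  (`matomaki_radziwill_of_vk`, `…_of_khale`), through the proved `MatomakiRadziwill2016_theorem1_of_theorem3`
  and `matomaki_radziwill_of_theorem1`.

So the trust base of Theorems 1 and 3 of Matomäki–Radziwiłł in the tree is exactly ONE input: a
Vinogradov–Korobov zero-free region `HasVKZeroFreeRegion c T₀` for some `c > 0` (e.g. the named fact
`Khale2024_zeroFreeRegion`).  Mathematically only the Riemann zeta function enters (Lemma 2 and Lemma 11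
of the paper use "the zero-free region for the Riemann zeta-function" of Vinogradov–Korobov strength);
the interface `HasVKZeroFreeRegion` is stated for all Dirichlet characters and is used here at the
level-one character.

## References
* K. Matomäki, M. Radziwiłł, *Multiplicative functions in short intervals*, Ann. of Math. (2) 183 (2016),
  1015–1056, doi:10.4007/annals.2016.183.3.6 (arXiv:1501.04585): Theorem 3 (p. 6, proof §9), Theorem 1,
  Lemma 4 (§2), Lemmas 2, 3, 11, Proposition 1. [MatomakiRadziwillAnnals2016]
* A. Granville, K. Soundararajan, Canad. J. Math. 55 (2003), Theorem 4, Corollary 3. [GranvilleSoundararajan2003]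
* T. Khale, Q. J. Math. 75 (2024), 299–332, Theorem 1.1 and (1.4). [Khale2024]
-/

namespace Literature.NumberTheory.Sieve

open Literature.NumberTheory.LFunctions Literature.NumberTheory.LFunctions.GranvilleSoundararajan

/-! ### Lemma 4, unconditionally -/

/-- **Matomäki–Radziwiłł 2016, eq. (Lipsch) of the proof of Lemma 4**, PROVED: for real multiplicative
`|f| ≤ 1` and `X/4 ≤ Y ≤ X`, `|(1/X) ∑_{n ≤ X} f(n) − (1/Y) ∑_{n ≤ Y} f(n)| ≪ (log X)^{-1/4}` (as rendered by
the named fact `MatomakiRadziwill2016_lemma4_lipschitz`), from the Granville–Soundararajan inputs, all proved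
in the tree (Theorem 1, Lemma 2.3, Theorem 3, Theorem 4 for central maximisers, Corollary 3, Lemma 7.1).
[cite: MatomakiRadziwillAnnals2016, Lemma 4 (proof, eq. Lipsch)] -/
theorem MatomakiRadziwill2016_lemma4_lipschitz_holds : MatomakiRadziwill2016_lemma4_lipschitz :=
  MatomakiRadziwill2016_lemma4_lipschitz_of_theorem4_central GranvilleSoundararajan2003_theorem4_central_holds

/-- **Matomäki–Radziwiłł 2016, Lemma 4** (the Lipschitz estimate for averages of a real multiplicative
`f : ℕ → [-1, 1]` on intervals `[x, x + y]`, `x ∈ [X, 2X]`, `X/(log X)^{1/5} ≤ y ≤ X`: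
`(1/y) ∑_{x ≤ n ≤ x+y} f(n) = (1/X) ∑_{X ≤ n ≤ 2X} f(n) + O((log X)^{-1/20})`), PROVED.
[cite: MatomakiRadziwillAnnals2016, Lemma 4] -/
theorem MatomakiRadziwill2016_lemma4_holds : MatomakiRadziwill2016_lemma4 :=
  MatomakiRadziwill2016_lemma4_of_theorem4_central GranvilleSoundararajan2003_theorem4_central_holds

/-! ### Theorem 3, Theorem 1 and parity.S38 from a Vinogradov–Korobov region -/

/-- **Matomäki–Radziwiłł 2016, Theorem 3, from any Vinogradov–Korobov zero-free region**
`HasVKZeroFreeRegion c T₀` (`c > 0`): §9 of the paper (`MatomakiRadziwill2016_theorem3_of_prop1_real`) with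
Lemma 14 and Lemma 4 proved, Proposition 1 by §8 (`MatomakiRadziwill2016_prop1_of_lemma3_lemma11`) from
Lemma 3 (`MatomakiRadziwill2016_lemma3_of_GS_tail` with `GranvilleSoundararajan2003_theorem1_holds` and the
prime tail `TwistedPrimeSumTail.pretentiousDistSq_one_twist_tail_ge_of_vk` at `θ = 7/10`) and Lemma 11
(`MatomakiRadziwill2016_lemma11_of_vk`). [cite: MatomakiRadziwillAnnals2016, Theorem 3 and §9] -/
theorem MatomakiRadziwill2016_theorem3_of_vk {c T₀ : ℝ} (hc : 0 < c) (hVK : HasVKZeroFreeRegion c T₀) :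
    MatomakiRadziwill2016_theorem3 :=
  MatomakiRadziwill2016_theorem3_of_prop1_real MatomakiRadziwill2016_lemma14_real_holds
    MatomakiRadziwill2016_lemma4_holds
    (MatomakiRadziwill2016_prop1_of_lemma3_lemma11
      (MatomakiRadziwill2016_lemma3_of_GS_tail GranvilleSoundararajan2003_theorem1_holds
        (TwistedPrimeSumTail.pretentiousDistSq_one_twist_tail_ge_of_vk hc hVK (θ := 7 / 10) (by norm_num)))
      (MatomakiRadziwill2016_lemma11_of_vk hc hVK))

/-- **Matomäki–Radziwiłł 2016, Theorem 3, from Khale's explicit Vinogradov–Korobov region alone** (the named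
fact `Khale2024_zeroFreeRegion`, i.e. `HasVKZeroFreeRegion (1/61.5) 10`).
[cite: MatomakiRadziwillAnnals2016, Theorem 3] [cite: Khale2024, Theorem 1.1] -/
theorem MatomakiRadziwill2016_theorem3_of_khale (hK : Khale2024_zeroFreeRegion) :
    MatomakiRadziwill2016_theorem3 :=
  MatomakiRadziwill2016_theorem3_of_vk (by norm_num) (hasVKZeroFreeRegion_of_khale hK)

/-- **Matomäki–Radziwiłł 2016, Theorem 1** (the named fact `MatomakiRadziwill2016_theorem1`), **from any
Vinogradov–Korobov zero-free region** — through `MatomakiRadziwill2016_theorem1_of_theorem3` (the deduction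
of Theorem 1 from Theorem 3 printed after Theorem 3, proved in `MatomakiRadziwillTheorem1.lean`).
[cite: MatomakiRadziwillAnnals2016, Theorem 1] -/
theorem MatomakiRadziwill2016_theorem1_of_vk {c T₀ : ℝ} (hc : 0 < c) (hVK : HasVKZeroFreeRegion c T₀) :
    MatomakiRadziwill2016_theorem1 :=
  MatomakiRadziwill2016_theorem1_of_theorem3 (MatomakiRadziwill2016_theorem3_of_vk hc hVK)

/-- **Matomäki–Radziwiłł 2016, Theorem 1, from Khale's region alone.**
[cite: MatomakiRadziwillAnnals2016, Theorem 1] [cite: Khale2024, Theorem 1.1] -/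
theorem MatomakiRadziwill2016_theorem1_of_khale (hK : Khale2024_zeroFreeRegion) :
    MatomakiRadziwill2016_theorem1 :=
  MatomakiRadziwill2016_theorem1_of_vk (by norm_num) (hasVKZeroFreeRegion_of_khale hK)

/-- **parity.S38 (`matomaki_radziwill`) from any Vinogradov–Korobov zero-free region.**
[cite: MatomakiRadziwillAnnals2016, Theorem 1] -/
theorem matomaki_radziwill_of_vk {c T₀ : ℝ} (hc : 0 < c) (hVK : HasVKZeroFreeRegion c T₀) :
    matomaki_radziwill :=
  matomaki_radziwill_of_theorem1 (MatomakiRadziwill2016_theorem1_of_vk hc hVK)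

/-- **parity.S38 (`matomaki_radziwill`) from Khale's region alone.**
[cite: MatomakiRadziwillAnnals2016, Theorem 1] [cite: Khale2024, Theorem 1.1] -/
theorem matomaki_radziwill_of_khale (hK : Khale2024_zeroFreeRegion) : matomaki_radziwill :=
  matomaki_radziwill_of_vk (by norm_num) (hasVKZeroFreeRegion_of_khale hK)

end Literature.NumberTheory.Sieve
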